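import Mathlib
import Literature.MathematicalPhysics.QuantumFieldTheory.Balaban1983to89.B6TorusFarCorrection
import Literature.MathematicalPhysics.QuantumFieldTheory.Balaban1983to89.B6Expansion286TowerTorus

/-!
# `Balaban1983to89.B6ModifiedPrescription270Torus` — T. Bałaban, *Propagators and renormalization transformations for lattice gauge theories. II*,
Commun. Math. Phys. **96** (1984) 223–250 [Balaban1984PropagatorsII]: **the MODIFIED prescription of (2.70) on the one-scale torus family —
`C_□ = ((Q′G′(□̃)²Q′*)↾□)⁻¹` with `G′(□̃)` the Green's function `Δ′_a⁻¹` of the cube `□̃` IDENTIFIED WITH A TORUS `T_□̃` — the cube charts,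
cores, cut-offs and zones of every cube of the cover, the honest `X̃_□ = (Q′G′(□̃)²Q′*)↾□`, its compression inverse `C_□`, (2.70) as the
operator identity, (2.82) for the modified prescription, (2.81) and (2.68) for the transplanted objects, and the chart geometry feeding the
p. 238 change-of-domain chain.**

statement-level skeleton of published theorems with citation tags; proofs where landed; nothing here is a claim about the Yang–Mills mass gap

Phase-2 PROOF SEAT p01 (gen 8) of the cell `lit-balaban` (HOME `run/shared/lean/pub/lit-balaban/`), free-target protocol G.5-34(d), own lane;
file 7 of the programme «the MODIFIED prescription of (2.70) with `G′(□̃)` on the torus `T_□̃` and the p. 238 change-of-domain sentence,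
genuine».  Sources read as page images: `run/shared/lean/pub/pub-balaban/b2b-balaban-ref1/pages/1984-cmp96-propagators-rt-II/
1984-cmp96-propagators-rt-II-p013-x2.png` (p. 235), `…-p015-x2.png` (p. 237), `…-p016-x2.png` (p. 238); journal page = PDF page + 222.

THE PRINTED TEXT.  p. 235 [PDF 13]: *"Let us consider the operators (Q′G′²Q′*)↾□ … We change this prescription a little bit; we take a
second cube □̃ containing □ in the middle and of the size 4M and we take an inverse of the operator (Q′G′(□̃)²Q′*)↾□ instead of
(Q′G′²Q′*)↾□. … Now let us define C = Σ_{□⊂𝒟} h_□C_□h_□. (2.70)"*; (2.81) p. 237: *"|C_□(y, y′)| ≤ O(1)(L^jη)^{−d−4}e^{−δ₁(L^jη)^{−1}|y−y′|}"*;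
(2.82) p. 237 (the three lines of `R`); p. 238: *"the operator with G′(□̃)² − G′² is small and an estimate has the factor exp(−δ₀M)"*;
p. 238 bottom: *"We take the cube □̃³ and identify it with a torus, denoted by T_□, imposing periodicity conditions."*

THE READING (declared, as in `…B6TorusTransplant`): `□̃` := the window of unit side `2H`, `H = L^{m′}`, centred at the centre of `□` (radius
`M` = `Mb`), identified with the torus `T_□̃ = T′` of the member `P′ = (d, L, m′, K)` of the family; `G′(□̃) := Δ′_a⁻¹` on `T′` (periodic
boundary conditions); sizes `H ≥ 5M + 5`, `m′ ≤ m` (`ChartHyps`).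

WHAT THIS FILE PROVES (kernel-checked, 0 sorry, axioms standard).  For a member `P`, cube size `Mb`, window exponent `m′` under `ChartHyps`,
and every cube `k` of the cover `B6CoverTorus` of `T₁^{(K)}`:
* §1 THE CUBE CHART: corner `cc k = ctr k − H·1`, offset `t_k(y) = woff(y) − H`; `□_k = {|t_k| ≤ M}` (`inCube_iff_abs_le`), core
  `Vk = {2|t_k| ≤ H}` ⊃ □_k, deep and half-period (`deep_of_mem_Vk`, `half_of_mem_Vk`); the cut-off `χ_k = chiCut (cc k) H M` is `1` on the
  blocks of □_k and their neighbours (`chi_eq_one_of_inCube`), its 2-thickened support lies over `Vk` (`chi_support_Vk`); the zone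
  `N_k = 𝔅 ∖ Core` is non-empty and at `|·|₁`-distance `≥ (M − 1)/2` from □_k (`depth_cube_zone`); the far zone of `T′` is at
  `|·|′₁`-distance `≥ (H − 2M − 2)/2` from `ι_K□_k` (`depth_cube_far`).
* §2 **THE MODIFIED PRESCRIPTION**: `X̃_k(y, y″) = □_k(y)·(Q′G′_{T′}²Q′*)(ι_Ky, ι_Ky″)·□_k(y″)` (`Xloc`) — `(Q′G′(□̃)²Q′*)↾□` extended by
  zero; `C_k = (X̃_k↾□_k)⁻¹` (`ClocT`, through the compression of `Q′G′_{T′}²Q′*` along the injection `ι_K∘(□_k ↪ 𝔅)`); **(2.70) PROVED**: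
  `Σ_{z∈□}X̃_k(y, z)C_k(z, y″) = δ_{yy″}` (`sum_cubeInd_Xloc_ClocT`) and the operator identity `(□X̃_k□)·C_k·h_k = h_k`
  (`locOp_mul_ClocTMat_mul_Hmat`); **(2.82)** `Q′G′²Q′*·C = 1 − R` and the fixed-point form of (2.86) for the modified `C`, `R`
  (`expansion282_modified`, `inv_eq_CappT_add`).
* §3 **(2.81) for the modified `C_□`**, uniformly on the family: `|C_k(y, y′)| ≤ B_C·e^{−δ_C|y−y′|₁}` ([3] Sect. 5 for the compression of the
  coercive decaying `Q′G′_{T′}²Q′*` along `ι_K`, then `|ι_Ky − ι_Ky′|′₁ ≥ |y − y′|₁` on the core) (`ineq281_modified`); **(2.68) for `X̃_k`**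
  (`abs_Xloc_le`).

HONEST SCOPE ∕ NOT CLAIMED.  Periodic (not Neumann) `G′(□̃)`; `□̃` of side `2L^{m′}` (the family's sizes) rather than the printed `4M`;
one scale, scalar model; the assembly of Proposition 2.3 with these objects and the p. 238 bound is the sibling `…B6Expansion286ModifiedTorus`.
Value = the modified prescription made of genuine operators with every located input proved, NOT summit progress.
-/

namespace Literature.MathematicalPhysics.QuantumFieldTheory.Balaban1983to89.B6ModifiedPrescription270Torus

open Finset Matrix
open QGQInverse (Coercive)
open B4Sect5Torus (IsPseudoDist ccoord ccoord_cast circAbs_le_tdist Hyp56 hyp56_submatrix isUnit_of_hyp56 inv_submatrix_decay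
  SumBound)
open B4TorusKernel.MultiPeriod (circAbs circAbs_nonneg circAbs_le_abs)
open B1RG242Torus (tower Qk Qks lvl lvl_of_le)
open B5Ineq137Torus (blk fine toT Nv Nv_pos)
open B6Prop22OneScaleTorus (T1 oneScaleGeo Index blk_fine)
open B6Lemma21TowerTorus (T1_triangle T1_symm T1_nonneg sum_exp_T1_le)
open B6QGGQInvTowerTorus (wQ wQ_pos qggqK qggqK_isUnit T1_isPseudoDist T1_self T1_sumBound hyp56_qggqK coercive_qggqK_of_qgqK)
open B6QGQCoerciveTowerTorus (Cq Cq_pos coercive_qgq coercive_qgq_family)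
open B6Ineq268OneScaleTorus (ineq268_oneScaleTorus)
open B6CoverTorus (CIdx ctr cd hcov InCube cubeInd cubeInd_eq_one cubeInd_eq_zero inCube_of_hcov_ne_zero cubeInd_mul_hcov
  cubeInd_zero_or_one)
open B6Expansion282 (mulOp kerOp locOp Cglued R282 PartitionSq expansion282 inverse_fixedPoint neumann_truncation mulOp_apply kerOp_apply)
open B6Expansion286TowerTorus (Cube Pmat Hmat Pmat_mul_Hmat partitionSq_Hmat)
open B6TorusWindowChart B6TorusCutoffChi B6TorusTransplant B6TransplantMajorants B6TorusFarCorrection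

noncomputable section

variable (P : Params) (Mb m' : ℕ)

/-! ## §1  The cube chart: corner, offset, core, cut-off, zone, depths -/

/-- `H = L^{m′}`: half the unit side of the window `□̃` (= `N′_K/2`, `N′_K = 2L^{m′}` the unit period of `T_□̃`).
[cite: Balaban1984PropagatorsII, p.235 («a second cube □̃ containing □ in the middle»)] -/
def Hh : ℕ := P.L ^ m'

/-- **the chart corner of the cube `k`**: `c_k = ctr_k − H·1`, so that the centre of `□_k` has chart coordinate `(H, …, H)` — the middle of
the window. [cite: Balaban1984PropagatorsII, p.235 («containing □ in the middle»)] -/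
def cc (k : CIdx P P.K Mb) : Site P P.K := fun μ => ctr P P.K Mb k μ - ((Hh P m' : ℕ) : ZMod (P.sitesPerDir P.K))

/-- **the core `V_k`** of the window of cube `k`: unit sites with `2|woff_k(y) − H| ≤ H` in every coordinate (the middle half of `□̃`).
[cite: Balaban1984PropagatorsII, p.238; bookkeeping] -/
def Vk (k : CIdx P P.K Mb) : Finset (Site P P.K) :=
  univ.filter fun y => ∀ μ, 2 * |(woff P P.K (cc P Mb m' k) y μ : ℤ) - Hh P m'| ≤ Hh P m'

/-- **the size hypotheses of the charts**: `M ≥ 2`, `H ≥ 5M + 5`, `m′ ≤ m` (the window fits in the torus: `2H ≤ N_K`).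
[cite: Balaban1984PropagatorsII, p.235 («of the size 4M»), p.238; bookkeeping] -/
structure ChartHyps : Prop where
  two_le : 2 ≤ Mb
  H_large : 5 * Mb + 5 ≤ Hh P m'
  m'_le : m' ≤ P.m

variable {P Mb m'}

section Geometry

variable (hc : ChartHyps P Mb m')
include hc

omit hc in
/-- `N′_K = 2H`. [cite: Balaban1984PropagatorsII, (2.1) p.224; bookkeeping] -/
theorem sitesPerDir_small' : (smallVol P m').sitesPerDir P.K = 2 * Hh P m' := by
  rw [sitesPerDir_smallVol]
  unfold Hh
  simp

/-- `2H ≤ N_K` (the window fits). [cite: Balaban1984PropagatorsII, p.235; bookkeeping] -/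
theorem two_Hh_le : 2 * Hh P m' ≤ P.sitesPerDir P.K := by
  rw [← sitesPerDir_small']
  exact sitesPerDir_smallVol_le P hc.m'_le P.K

/-- numeric consequences used below: `1 ≤ M`, `2M ≤ H`, `H < N_K`, `7M + 4 ≤ 4H`, `4H + 7M + 8 ≤ 4N_K`.
[cite: Balaban1984PropagatorsII, p.235; bookkeeping] -/
theorem sizes : 1 ≤ Mb ∧ 2 * Mb ≤ Hh P m' ∧ Hh P m' < P.sitesPerDir P.K ∧ 7 * Mb + 4 ≤ 4 * Hh P m' ∧
    4 * Hh P m' + 7 * Mb + 8 ≤ 4 * P.sitesPerDir P.K := by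
  have h1 := hc.two_le
  have h2 := hc.H_large
  have h3 := two_Hh_le hc
  omega

/-- the chart coordinate of the centre is `H`. [cite: Balaban1984PropagatorsII, p.235; bookkeeping] -/
theorem woff_cc_ctr (k : CIdx P P.K Mb) (μ : Fin P.d) : woff P P.K (cc P Mb m' k) (ctr P P.K Mb k) μ = Hh P m' := by
  have hlt : Hh P m' < P.sitesPerDir P.K := (sizes hc).2.2.1
  show (ctr P P.K Mb k μ - (ctr P P.K Mb k μ - ((Hh P m' : ℕ) : ZMod (P.sitesPerDir P.K)))).val = Hh P m'
  rw [sub_sub_cancel, ZMod.val_natCast, Nat.mod_eq_of_lt hlt]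

/-- the offset `t_k(y) = woff_k(y) − H` lies in `[−H, N − H)`: `|t| ≤ N − H` (`2H ≤ N`). [cite: Balaban1984PropagatorsII, p.235; bookkeeping] -/
theorem abs_off_le (k : CIdx P P.K Mb) (y : Site P P.K) (μ : Fin P.d) :
    |(woff P P.K (cc P Mb m' k) y μ : ℤ) - Hh P m'| ≤ (P.sitesPerDir P.K : ℤ) - Hh P m' := by
  have h1 := woff_lt P.K (cc P Mb m' k) y μ
  have h2 := two_Hh_le hc
  rw [abs_le]; constructor <;> omega

/-- `|t_k(y)| < N`. [cite: Balaban1984PropagatorsII, p.235; bookkeeping] -/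
theorem abs_off_lt (k : CIdx P P.K Mb) (y : Site P P.K) (μ : Fin P.d) :
    |(woff P P.K (cc P Mb m' k) y μ : ℤ) - Hh P m'| < P.sitesPerDir P.K := by
  have h := abs_off_le hc k y μ
  have hH : 1 ≤ Hh P m' := by have := hc.H_large; omega
  have hH' : (1 : ℤ) ≤ Hh P m' := by exact_mod_cast hH
  linarith

omit hc in
/-- the circular distance of an integer of modulus `< N`: `circAbs N t = min(|t|, N − |t|)`. [folklore] -/
private theorem circAbs_eq_min {N : ℕ} {t : ℤ} (ht : |t| < N) : circAbs N t = min |t| ((N : ℤ) - |t|) := by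
  unfold circAbs
  rcases le_or_gt 0 t with h0 | h0
  · rw [abs_of_nonneg h0] at ht ⊢
    rw [Int.emod_eq_of_lt h0 ht]
  · rw [abs_of_neg h0] at ht ⊢
    have h1 : t % (N : ℤ) = t + N := by
      rw [← Int.add_mul_emod_self_right t 1 (N : ℤ), one_mul]
      exact Int.emod_eq_of_lt (by omega) (by omega)
    rw [h1, min_comm]
    congr 1 <;> ring

omit hc in
/-- a coordinate of the unit distance: `circAbs_N(woff y − woff y′)_μ ≤ |y − y′|₁`. [cite: Balaban1984PropagatorsII, (2.46) p.231; bookkeeping] -/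
theorem circAbs_woff_le_T1 (j : ℕ) (c y y' : Site P j) (μ : Fin P.d) :
    (circAbs (P.sitesPerDir j) ((woff P j c y μ : ℤ) - (woff P j c y' μ : ℤ)) : ℝ) ≤ T1 P j y y' := by
  have h1 : ccoord (Nv P j) (toT y) (toT y') μ ≤ ∑ ν, ccoord (Nv P j) (toT y) (toT y') ν :=
    Finset.single_le_sum (f := fun ν => ccoord (Nv P j) (toT y) (toT y') ν) (fun ν _ => Nat.zero_le _) (Finset.mem_univ μ)
  have e := ccoord_eq_circAbs_woff j c y y' μ
  have h2 : ((ccoord (Nv P j) (toT y) (toT y') μ : ℕ) : ℝ) ≤ ((∑ ν, ccoord (Nv P j) (toT y) (toT y') ν : ℕ) : ℝ) := by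
    exact_mod_cast h1
  have e' : ((ccoord (Nv P j) (toT y) (toT y') μ : ℕ) : ℝ) = (circAbs (P.sitesPerDir j) ((woff P j c y μ : ℤ) - (woff P j c y' μ : ℤ)) : ℝ) := by
    exact_mod_cast e
  unfold T1
  rw [← e']
  exact h2

/-- **the coordinate distance to the centre is the circular size of the offset**: `cd(y, ctr_k)_μ = circAbs_N(t_k(y)_μ) = min(|t|, N − |t|)`.
[cite: Balaban1984PropagatorsII, (2.46) p.231; bookkeeping] -/
theorem cd_ctr_eq (k : CIdx P P.K Mb) (y : Site P P.K) (μ : Fin P.d) :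
    ((cd P P.K y (ctr P P.K Mb k) μ : ℕ) : ℤ) =
      min |(woff P P.K (cc P Mb m' k) y μ : ℤ) - Hh P m'| ((P.sitesPerDir P.K : ℤ) - |(woff P P.K (cc P Mb m' k) y μ : ℤ) - Hh P m'|) := by
  unfold cd
  rw [ccoord_eq_circAbs_woff P.K (cc P Mb m' k) y (ctr P P.K Mb k) μ, woff_cc_ctr hc, circAbs_eq_min (abs_off_lt hc k y μ)]

/-- **`□_k` in the chart**: `y ∈ □_k ⟺ |t_k(y)_μ| ≤ M` for every `μ` (no wrap-around: `M < H`, `M < N − H`).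
[cite: Balaban1984PropagatorsII, p.229 («a cube □ of the size 2M»), p.235] -/
theorem inCube_iff_abs_le (k : CIdx P P.K Mb) (y : Site P P.K) :
    InCube P P.K Mb k y ↔ ∀ μ, |(woff P P.K (cc P Mb m' k) y μ : ℤ) - Hh P m'| ≤ Mb := by
  have hs := sizes hc
  have hs1 : (1 : ℤ) ≤ Mb := by exact_mod_cast hs.1
  have hs2 : (2 * Mb : ℤ) ≤ Hh P m' := by exact_mod_cast hs.2.1
  unfold InCube
  refine forall_congr' fun μ => ?_
  have hcd := cd_ctr_eq hc k y μ
  constructor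
  · intro h
    have h' : ((cd P P.K y (ctr P P.K Mb k) μ : ℕ) : ℤ) ≤ Mb := by exact_mod_cast h
    rw [hcd] at h'
    rcases min_le_iff.mp h' with h1 | h1
    · exact h1
    · exfalso
      have hb := abs_off_le hc k y μ
      linarith
  · intro h
    have h' : ((cd P P.K y (ctr P P.K Mb k) μ : ℕ) : ℤ) ≤ Mb := by rw [hcd]; exact (min_le_left _ _).trans h
    exact_mod_cast h'

/-- `supp h_k ⊂ □_k` in the chart: `h_k(y) ≠ 0 ⟹ |t_k(y)| ≤ M`. [cite: Balaban1984PropagatorsI, (1.118) p.36; Balaban1984PropagatorsII, (2.36) p.229] -/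
theorem abs_le_of_hcov_ne_zero {k : CIdx P P.K Mb} {y : Site P P.K} (h : hcov P P.K Mb k y ≠ 0) (μ : Fin P.d) :
    |(woff P P.K (cc P Mb m' k) y μ : ℤ) - Hh P m'| ≤ Mb :=
  (inCube_iff_abs_le hc k y).mp (inCube_of_hcov_ne_zero (sizes hc).1 h) μ

/-- `{|t_k| ≤ M} ⊂ V_k` (`2M ≤ H`). [cite: Balaban1984PropagatorsII, p.235 («containing □ in the middle»)] -/
theorem mem_Vk_of_abs_le {k : CIdx P P.K Mb} {y : Site P P.K} (h : ∀ μ, |(woff P P.K (cc P Mb m' k) y μ : ℤ) - Hh P m'| ≤ Mb) :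
    y ∈ Vk P Mb m' k := by
  have hs2 : (2 * Mb : ℤ) ≤ Hh P m' := by exact_mod_cast (sizes hc).2.1
  refine Finset.mem_filter.mpr ⟨Finset.mem_univ _, fun μ => ?_⟩
  have := h μ
  linarith

/-- `□_k ⊂ V_k`. [cite: Balaban1984PropagatorsII, p.235; bookkeeping] -/
theorem mem_Vk_of_inCube {k : CIdx P P.K Mb} {y : Site P P.K} (h : InCube P P.K Mb k y) : y ∈ Vk P Mb m' k :=
  mem_Vk_of_abs_le hc ((inCube_iff_abs_le hc k y).mp h)

/-- the core blocks are deep blocks of the window (`1 ≤ woff ≤ 2H − 2`). [cite: Balaban1984PropagatorsII, p.238; bookkeeping] -/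
theorem deep_of_mem_Vk {k : CIdx P P.K Mb} {y : Site P P.K} (hy : y ∈ Vk P Mb m' k) : DeepBlk P (cc P Mb m' k) m' y := by
  have h := (Finset.mem_filter.mp hy).2
  have hH : 4 ≤ Hh P m' := by have := hc.H_large; omega
  intro μ
  have h1 := h μ
  rw [sitesPerDir_small']
  rcases le_or_gt 0 ((woff P P.K (cc P Mb m' k) y μ : ℤ) - Hh P m') with h0 | h0
  · rw [abs_of_nonneg h0] at h1
    constructor <;> omega
  · rw [abs_of_neg h0] at h1
    constructor <;> omega

/-- core blocks are window blocks. [cite: Balaban1984PropagatorsII, p.238; bookkeeping] -/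
theorem inW_of_mem_Vk {k : CIdx P P.K Mb} {y : Site P P.K} (hy : y ∈ Vk P Mb m' k) : InW P (cc P Mb m' k) m' y :=
  inW_of_deepBlk (deep_of_mem_Vk hc hy)

omit hc in
/-- the half-period condition on the core: `2|woff y − woff y′| ≤ 2H = N′_K` for `y, y′ ∈ V_k`. [cite: Balaban1984PropagatorsII, p.238; bookkeeping] -/
theorem half_of_mem_Vk {k : CIdx P P.K Mb} {y y' : Site P P.K} (hy : y ∈ Vk P Mb m' k) (hy' : y' ∈ Vk P Mb m' k) (μ : Fin P.d) :
    2 * |(woff P P.K (cc P Mb m' k) y μ : ℤ) - (woff P P.K (cc P Mb m' k) y' μ : ℤ)| ≤ (smallVol P m').sitesPerDir P.K := by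
  have h1 := (Finset.mem_filter.mp hy).2 μ
  have h2 := (Finset.mem_filter.mp hy').2 μ
  have htri := abs_sub_le ((woff P P.K (cc P Mb m' k) y μ : ℤ)) (Hh P m' : ℤ) ((woff P P.K (cc P Mb m' k) y' μ : ℤ))
  rw [abs_sub_comm (Hh P m' : ℤ)] at htri
  rw [sitesPerDir_small']
  push_cast
  linarith

/-- `|y − y′|₁ ≤ |ι_Ky − ι_Ky′|′₁` on the core. [cite: Balaban1984PropagatorsII, p.238; bookkeeping] -/
theorem T1_le_T1_iotaK_of_mem_Vk {k : CIdx P P.K Mb} {y y' : Site P P.K} (hy : y ∈ Vk P Mb m' k) (hy' : y' ∈ Vk P Mb m' k) :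
    T1 P P.K y y' ≤ T1 (smallVol P m') P.K (iotaK P (cc P Mb m' k) m' y) (iotaK P (cc P Mb m' k) m' y') :=
  T1_le_T1_iotaK (inW_of_mem_Vk hc hy) (inW_of_mem_Vk hc hy') (half_of_mem_Vk hy hy')

/-- blocks with `|t_k| ≤ M` are core blocks of the cut-off chart `(cc k, H, M)` (`M ≥ 2`). [cite: Balaban1984PropagatorsII, p.239 («equal to 1 on a cube containing □»)] -/
theorem mem_Core_of_abs_le {k : CIdx P P.K Mb} {y : Site P P.K} (h : ∀ μ, |(woff P P.K (cc P Mb m' k) y μ : ℤ) - Hh P m'| ≤ Mb) :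
    y ∈ Core P (cc P Mb m' k) (Hh P m') Mb := by
  have h2 : (2 : ℤ) ≤ Mb := by exact_mod_cast hc.two_le
  refine Finset.mem_filter.mpr ⟨Finset.mem_univ _, fun μ => ?_⟩
  have := h μ
  linarith

/-- **`χ_k = 1` on the blocks of `□_k` and on their fine neighbours.** [cite: Balaban1984PropagatorsII, p.239; (2.44) p.230] -/
theorem chi_eq_one_of_inCube {k : CIdx P P.K Mb} {x : Site P 0} (hx : InCube P P.K Mb k (blk P P.K x)) :
    chiCut P (cc P Mb m' k) (Hh P m') Mb x = 1 ∧
      ∀ ν, chiCut P (cc P Mb m' k) (Hh P m') Mb (x.shift ν) = 1 ∧ chiCut P (cc P Mb m' k) (Hh P m') Mb (x.unshift ν) = 1 := by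
  have hs := sizes hc
  exact chiCut_eq_one_near_core hs.1 hs.2.2.2.1 hs.2.2.2.2 (mem_Core_of_abs_le hc ((inCube_iff_abs_le hc k _).mp hx))

/-- `χ_k = 1` on the fine sites over core blocks of the chart. [cite: Balaban1984PropagatorsII, p.239; bookkeeping] -/
theorem chi_eq_one_of_mem_Core {k : CIdx P P.K Mb} {x : Site P 0} (hx : blk P P.K x ∈ Core P (cc P Mb m' k) (Hh P m') Mb) :
    chiCut P (cc P Mb m' k) (Hh P m') Mb x = 1 := by
  have hs := sizes hc
  exact (chiCut_eq_one_near_core hs.1 hs.2.2.2.1 hs.2.2.2.2 hx).1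

/-- **the 2-thickened support of `χ_k` lies over the core `V_k`**: `χ_k(x″) ≠ 0` and `|blk x″ − y|₁ ≤ 2` imply `y ∈ V_k`.
[cite: Balaban1984PropagatorsII, p.239 («equal to 0 outside a similar cube»); bookkeeping] -/
theorem chi_support_Vk {k : CIdx P P.K Mb} {x'' : Site P 0} (hx : chiCut P (cc P Mb m' k) (Hh P m') Mb x'' ≠ 0) (y : Site P P.K)
    (hT : T1 P P.K (blk P P.K x'') y ≤ 2) : y ∈ Vk P Mb m' k := by
  have hs := sizes hc
  have hH : (5 * Mb + 5 : ℤ) ≤ Hh P m' := by exact_mod_cast hc.H_large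
  have hMb0 : (0 : ℤ) ≤ Mb := by positivity
  refine Finset.mem_filter.mpr ⟨Finset.mem_univ _, fun μ => ?_⟩
  set ty : ℤ := (woff P P.K (cc P Mb m' k) y μ : ℤ) - Hh P m' with hty
  set tx : ℤ := (woff P P.K (cc P Mb m' k) (blk P P.K x'') μ : ℤ) - Hh P m' with htx
  -- the support: 4|t(blk x″)| < 7M + 2
  have hsupp : 4 * |tx| < 7 * Mb + 2 := by
    by_contra hle
    exact hx (chiCut_eq_zero_of_far hs.1 (μ := μ) (not_lt.mp hle))
  -- the coordinate distance: circAbs(woff y − woff x″) ≤ 2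
  have hcirc : (circAbs (P.sitesPerDir P.K) ((woff P P.K (cc P Mb m' k) y μ : ℤ) - (woff P P.K (cc P Mb m' k) (blk P P.K x'') μ : ℤ)) : ℝ)
      ≤ 2 := (circAbs_woff_le_T1 P.K _ y _ μ).trans (by rw [T1_symm]; exact hT)
  have hcirc' : circAbs (P.sitesPerDir P.K) ((woff P P.K (cc P Mb m' k) y μ : ℤ) - (woff P P.K (cc P Mb m' k) (blk P P.K x'') μ : ℤ))
      ≤ 2 := by exact_mod_cast hcirc
  have eΔ : (woff P P.K (cc P Mb m' k) y μ : ℤ) - (woff P P.K (cc P Mb m' k) (blk P P.K x'') μ : ℤ) = ty - tx := by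
    rw [hty, htx]; ring
  have hty_le := abs_off_le hc k y μ
  have htx_le := abs_off_le hc k (blk P P.K x'') μ
  have htri1 := abs_sub_abs_le_abs_sub ty tx
  have htri2 := abs_sub ty tx
  have hlt : |ty - tx| < P.sitesPerDir P.K := by
    have h2H : (2 * Hh P m' : ℤ) ≤ P.sitesPerDir P.K := by exact_mod_cast two_Hh_le hc
    have : |ty - tx| ≤ |ty| + |tx| := htri2
    linarith
  rw [eΔ, circAbs_eq_min hlt] at hcirc'
  rcases min_le_iff.mp hcirc' with h1 | h1
  · show 2 * |ty| ≤ Hh P m'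
    linarith
  · exfalso
    linarith

/-- **the depth of `□_k` below the zone**: a site `n` outside the core of the chart is at `|·|₁`-distance `≥ (M − 1)/2` from every `y` with
`|t_k(y)| ≤ M`. [cite: Balaban1984PropagatorsII, p.238; bookkeeping] -/
theorem depth_cube_zone {k : CIdx P P.K Mb} {y : Site P P.K} (hy : ∀ μ, |(woff P P.K (cc P Mb m' k) y μ : ℤ) - Hh P m'| ≤ Mb)
    {n : Site P P.K} (hn : n ∈ Finset.univ \ Core P (cc P Mb m' k) (Hh P m') Mb) : ((Mb : ℝ) - 1) / 2 ≤ T1 P P.K y n := by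
  have hH : (5 * Mb + 5 : ℤ) ≤ Hh P m' := by exact_mod_cast hc.H_large
  have hn' : ¬ ∀ μ, 2 * (|(woff P P.K (cc P Mb m' k) n μ : ℤ) - Hh P m'| + 1) ≤ 3 * Mb := fun h =>
    (Finset.mem_sdiff.mp hn).2 (Finset.mem_filter.mpr ⟨Finset.mem_univ _, h⟩)
  obtain ⟨μ, hμ⟩ := not_forall.mp hn'
  have hμ' : 3 * (Mb : ℤ) < 2 * (|(woff P P.K (cc P Mb m' k) n μ : ℤ) - Hh P m'| + 1) := not_le.mp hμ
  refine le_trans ?_ (circAbs_woff_le_T1 P.K (cc P Mb m' k) y n μ)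
  set ty : ℤ := (woff P P.K (cc P Mb m' k) y μ : ℤ) - Hh P m' with hty
  set tn : ℤ := (woff P P.K (cc P Mb m' k) n μ : ℤ) - Hh P m' with htn
  have eΔ : (woff P P.K (cc P Mb m' k) y μ : ℤ) - (woff P P.K (cc P Mb m' k) n μ : ℤ) = ty - tn := by rw [hty, htn]; ring
  have hyμ : |ty| ≤ Mb := hy μ
  have htn_le : |tn| ≤ (P.sitesPerDir P.K : ℤ) - Hh P m' := abs_off_le hc k n μ
  have htri1 := abs_sub_abs_le_abs_sub tn ty
  have htri2 := abs_sub ty tn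
  rw [abs_sub_comm tn ty] at htri1
  have hlt : |ty - tn| < P.sitesPerDir P.K := by
    have h2H : (2 * Hh P m' : ℤ) ≤ P.sitesPerDir P.K := by exact_mod_cast two_Hh_le hc
    linarith
  rw [eΔ, circAbs_eq_min hlt]
  have key : (Mb : ℤ) - 1 ≤ 2 * min |ty - tn| ((P.sitesPerDir P.K : ℤ) - |ty - tn|) := by
    rcases min_choice |ty - tn| ((P.sitesPerDir P.K : ℤ) - |ty - tn|) with h | h <;> rw [h] <;> linarith
  have key' : ((Mb : ℝ) - 1) ≤ 2 * ((min |ty - tn| ((P.sitesPerDir P.K : ℤ) - |ty - tn|) : ℤ) : ℝ) := by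
    have h := (Int.cast_le (R := ℝ)).mpr key
    simpa only [Int.cast_sub, Int.cast_natCast, Int.cast_one, Int.cast_mul, Int.cast_ofNat] using h
  linarith

/-- the zone of the chart is non-empty: the corner `c_k` itself (`woff = 0`, `|t| = H > (3M − 2)/2`) lies outside the core.
[cite: Balaban1984PropagatorsII, p.238; bookkeeping] -/
theorem zone_nonempty (k : CIdx P P.K Mb) : (Finset.univ \ Core P (cc P Mb m' k) (Hh P m') Mb).Nonempty := by
  have hH : (5 * Mb + 5 : ℤ) ≤ Hh P m' := by exact_mod_cast hc.H_large
  refine ⟨cc P Mb m' k, Finset.mem_sdiff.mpr ⟨Finset.mem_univ _, fun h => ?_⟩⟩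
  have h0 := (Finset.mem_filter.mp h).2 ⟨0, P.hd⟩
  rw [woff_self] at h0
  simp only [Nat.cast_zero, zero_sub, abs_neg, Nat.abs_cast] at h0
  linarith

/-- **the depth of `ι_K□_k` below the far zone of `T′`**: for `|t_k(y)| ≤ M` and a far block `u` (the image of a window block outside `V_k`),
`|ι_Ky − u|′₁ ≥ (H − 2M − 2)/2`. [cite: Balaban1984PropagatorsII, p.238 («a change of a domain»); bookkeeping] -/
theorem depth_cube_far {k : CIdx P P.K Mb} {y : Site P P.K} (hy : ∀ μ, |(woff P P.K (cc P Mb m' k) y μ : ℤ) - Hh P m'| ≤ Mb)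
    {u : Site (smallVol P m') P.K} (hu : u ∈ farZone P (cc P Mb m' k) m' (Vk P Mb m' k)) :
    ((Hh P m' : ℝ) - 2 * Mb - 2) / 2 ≤ T1 (smallVol P m') P.K (iotaK P (cc P Mb m' k) m' y) u := by
  have hH : (5 * Mb + 5 : ℤ) ≤ Hh P m' := by exact_mod_cast hc.H_large
  obtain ⟨z, hz, rfl⟩ := Finset.mem_image.mp hu
  obtain ⟨hzW, hzV⟩ := (Finset.mem_filter.mp hz).2
  have hyV : y ∈ Vk P Mb m' k := mem_Vk_of_abs_le hc hy
  have hyW : InW P (cc P Mb m' k) m' y := inW_of_mem_Vk hc hyV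
  -- a coordinate where z is outside the core
  have hz' : ¬ ∀ μ, 2 * |(woff P P.K (cc P Mb m' k) z μ : ℤ) - Hh P m'| ≤ Hh P m' := fun h =>
    hzV (Finset.mem_filter.mpr ⟨Finset.mem_univ _, h⟩)
  obtain ⟨μ, hμ⟩ := not_forall.mp hz'
  have hμ' : (Hh P m' : ℤ) < 2 * |(woff P P.K (cc P Mb m' k) z μ : ℤ) - Hh P m'| := not_le.mp hμ
  -- the μ-th circular coordinate distance on T′, read in the chart of T′ (corner 0)
  have hcoord := circAbs_woff_le_T1 (P := smallVol P m') P.K (origin (smallVol P m') P.K) (iotaK P (cc P Mb m' k) m' y)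
    (iotaK P (cc P Mb m' k) m' z) μ
  rw [woff_iotaK hyW, woff_iotaK hzW, sitesPerDir_small'] at hcoord
  refine le_trans ?_ hcoord
  set ty : ℤ := (woff P P.K (cc P Mb m' k) y μ : ℤ) - Hh P m' with hty
  set tz : ℤ := (woff P P.K (cc P Mb m' k) z μ : ℤ) - Hh P m' with htz
  have eΔ : (woff P P.K (cc P Mb m' k) y μ : ℤ) - (woff P P.K (cc P Mb m' k) z μ : ℤ) = ty - tz := by rw [hty, htz]; ring
  have hyμ : |ty| ≤ Mb := hy μ
  have hwz := hzW μ
  rw [sitesPerDir_small'] at hwz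
  have htz_le : |tz| ≤ Hh P m' := by
    rw [abs_le]; constructor <;> omega
  have htri1 := abs_sub_abs_le_abs_sub tz ty
  have htri2 := abs_sub ty tz
  rw [abs_sub_comm tz ty] at htri1
  have hMb0 : (0 : ℤ) ≤ Mb := by positivity
  have hlt : |ty - tz| < ((2 * Hh P m' : ℕ) : ℤ) := by push_cast; linarith
  rw [eΔ, circAbs_eq_min hlt]
  have key : (Hh P m' : ℤ) - 2 * Mb - 2 ≤ 2 * min |ty - tz| (((2 * Hh P m' : ℕ) : ℤ) - |ty - tz|) := by
    rcases min_choice |ty - tz| (((2 * Hh P m' : ℕ) : ℤ) - |ty - tz|) with h | h <;> rw [h] <;> push_cast <;> linarith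
  have key' : ((Hh P m' : ℝ) - 2 * Mb - 2) ≤ 2 * ((min |ty - tz| (((2 * Hh P m' : ℕ) : ℤ) - |ty - tz|) : ℤ) : ℝ) := by
    have h := (Int.cast_le (R := ℝ)).mpr key
    simpa only [Int.cast_sub, Int.cast_natCast, Int.cast_one, Int.cast_mul, Int.cast_ofNat] using h
  linarith

end Geometry

/-! ## §2  The modified prescription: `X̃_□ = (Q′G′(□̃)²Q′*)↾□`, `C_□ = (X̃_□↾□)⁻¹`, (2.70), (2.82) -/

section Prescription

variable (P Mb m') (a msq : ℝ)

/-- **`X̃_□ = (Q′G′(□̃)²Q′*)↾□`** for the cube `k`, extended by zero: `X̃_k(y, y″) = □_k(y)·(Q′G′_{T′}²Q′*)(ι_Ky, ι_Ky″)·□_k(y″)` with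
`G′(□̃) = G′_{T′}` the Green's function of the torus `T′ = T_□̃` (`(B1RG242Torus.tower P′ a m²).G K`, read through the transplant `ι_K` of the
chart of `k`). [cite: Balaban1984PropagatorsII, p.235 («an inverse of the operator (Q′G′(□̃)²Q′*)↾□ instead of (Q′G′²Q′*)↾□»)] -/
def Xloc (k : CIdx P P.K Mb) (y y' : Site P P.K) : ℝ :=
  cubeInd P P.K Mb k y * qggqK (smallVol P m') a msq (iotaK P (cc P Mb m' k) m' y) (iotaK P (cc P Mb m' k) m' y') *
    cubeInd P P.K Mb k y'

/-- the embedding of the cube `□_k` into the unit lattice of `T′`: `y ↦ ι_Ky`. [cite: Balaban1984PropagatorsII, p.238; bookkeeping] -/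
def cubeEmb (k : CIdx P P.K Mb) : Cube P Mb k → Site (smallVol P m') P.K := fun s => iotaK P (cc P Mb m' k) m' s.val

/-- **`(Q′G′(□̃)²Q′*)↾□`** as a matrix on the sites of `□_k`: the compression of `Q′G′_{T′}²Q′*` along `ι_K∘(□_k ↪ 𝔅)`.
[cite: Balaban1984PropagatorsII, p.235 before (2.70)] -/
def AcompT (k : CIdx P P.K Mb) : Matrix (Cube P Mb k) (Cube P Mb k) ℝ :=
  (qggqK (smallVol P m') a msq).submatrix (cubeEmb P Mb m' k) (cubeEmb P Mb m' k)

open Classical in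
/-- **`C_□ = ((Q′G′(□̃)²Q′*)↾□)⁻¹`** of the modified prescription, as a kernel on `T₁^{(K)} × T₁^{(K)}` extended by zero off `□ × □`.
[cite: Balaban1984PropagatorsII, (2.70) p.235] -/
def ClocT (k : CIdx P P.K Mb) (y y' : Site P P.K) : ℝ :=
  if h : InCube P P.K Mb k y ∧ InCube P P.K Mb k y' then (AcompT P Mb m' a msq k)⁻¹ ⟨y, h.1⟩ ⟨y', h.2⟩ else 0

/-- `X̃_k` as a matrix. [cite: Balaban1984PropagatorsII, p.235; bookkeeping] -/
def XlocMat (k : CIdx P P.K Mb) : Matrix (Site P P.K) (Site P P.K) ℝ := Matrix.of (Xloc P Mb m' a msq k)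

/-- `C_k` as a matrix. [cite: Balaban1984PropagatorsII, (2.70) p.235; bookkeeping] -/
def ClocTMat (k : CIdx P P.K Mb) : Matrix (Site P P.K) (Site P P.K) ℝ := Matrix.of (ClocT P Mb m' a msq k)

/-- **`C = Σ_{□∈𝒟} h_□C_□h_□` of (2.70), MODIFIED PRESCRIPTION** (`B6Expansion282.Cglued` in the matrix ring of `T₁^{(K)}`).
[cite: Balaban1984PropagatorsII, (2.70) p.235] -/
def CappT : Matrix (Site P P.K) (Site P P.K) ℝ := Cglued (Hmat P Mb) (ClocTMat P Mb m' a msq)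

/-- **`R` of (2.82), MODIFIED PRESCRIPTION**, read off its three lines (`B6Expansion282.R282`): `X = Q′G′²Q′*` the genuine one-scale operator,
`X̃_□ = (Q′G′(□̃)²Q′*)↾□`; the third line `□(X̃_□ − X)h_□C_□h_□` is now NON-VOID. [cite: Balaban1984PropagatorsII, (2.82) p.237] -/
def RrwT : Matrix (Site P P.K) (Site P P.K) ℝ :=
  R282 (qggqK P a msq) (Pmat P Mb) (XlocMat P Mb m' a msq) (Hmat P Mb) (ClocTMat P Mb m' a msq)

variable {P Mb m' a msq}

/-- the cube embeds injectively into `T′` (`ι_K` is injective on the window, which contains `□_k`). [cite: Balaban1984PropagatorsII, p.238; bookkeeping] -/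
theorem cubeEmb_injective (hc : ChartHyps P Mb m') (k : CIdx P P.K Mb) : Function.Injective (cubeEmb P Mb m' k) := by
  intro s s' h
  exact Subtype.ext (iotaK_injOn (inW_of_mem_Vk hc (mem_Vk_of_inCube hc s.property))
    (inW_of_mem_Vk hc (mem_Vk_of_inCube hc s'.property)) h)

/-- `C_k(y, ·) = 0` for `y ∉ □_k`. [cite: Balaban1984PropagatorsII, (2.70) p.235; bookkeeping] -/
theorem ClocT_eq_zero_left {k : CIdx P P.K Mb} {y : Site P P.K} (hy : ¬ InCube P P.K Mb k y) (y' : Site P P.K) :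
    ClocT P Mb m' a msq k y y' = 0 := by
  unfold ClocT; rw [dif_neg (fun h => hy h.1)]

/-- `C_k(·, y′) = 0` for `y′ ∉ □_k`. [cite: Balaban1984PropagatorsII, (2.70) p.235; bookkeeping] -/
theorem ClocT_eq_zero_right {k : CIdx P P.K Mb} (y : Site P P.K) {y' : Site P P.K} (hy' : ¬ InCube P P.K Mb k y') :
    ClocT P Mb m' a msq k y y' = 0 := by
  unfold ClocT; rw [dif_neg (fun h => hy' h.2)]

/-- on `□ × □`, `C_k` is the inverse matrix of the compression. [cite: Balaban1984PropagatorsII, (2.70) p.235; bookkeeping] -/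
theorem ClocT_eq_inv {k : CIdx P P.K Mb} {y y' : Site P P.K} (hy : InCube P P.K Mb k y) (hy' : InCube P P.K Mb k y') :
    ClocT P Mb m' a msq k y y' = (AcompT P Mb m' a msq k)⁻¹ ⟨y, hy⟩ ⟨y', hy'⟩ := by
  unfold ClocT; rw [dif_pos ⟨hy, hy'⟩]

/-- `X̃_k(y, ·) = 0`, `X̃_k(·, y) = 0` off `□_k`. [cite: Balaban1984PropagatorsII, p.235; bookkeeping] -/
theorem Xloc_eq_zero_of_not_inCube {k : CIdx P P.K Mb} {y : Site P P.K} (hy : ¬ InCube P P.K Mb k y) (y' : Site P P.K) :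
    Xloc P Mb m' a msq k y y' = 0 ∧ Xloc P Mb m' a msq k y' y = 0 := by
  unfold Xloc; rw [cubeInd_eq_zero hy]; simp

/-- on `□ × □`, `X̃_k` is the transplanted `Q′G′_{T′}²Q′*`. [cite: Balaban1984PropagatorsII, p.235; bookkeeping] -/
theorem Xloc_eq_of_inCube {k : CIdx P P.K Mb} {y y' : Site P P.K} (hy : InCube P P.K Mb k y) (hy' : InCube P P.K Mb k y') :
    Xloc P Mb m' a msq k y y' = qggqK (smallVol P m') a msq (iotaK P (cc P Mb m' k) m' y) (iotaK P (cc P Mb m' k) m' y') := by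
  unfold Xloc; rw [cubeInd_eq_one hy, cubeInd_eq_one hy', one_mul, mul_one]

/-- a sum over `T₁^{(K)}` of a function vanishing off `□_k` is the sum over the cube. [folklore] -/
private theorem sum_eq_sum_cube (k : CIdx P P.K Mb) (F : Site P P.K → ℝ) (hF : ∀ z, ¬ InCube P P.K Mb k z → F z = 0) :
    ∑ z, F z = ∑ s : Cube P Mb k, F s.val :=
  B4Sect5Torus.sum_eq_sum_range (e := (Subtype.val : Cube P Mb k → Site P P.K)) Subtype.val_injective F
    (fun p hp => hF p (fun h => hp ⟨⟨p, h⟩, rfl⟩))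

/-- the compression `(Q′G′(□̃)²Q′*)↾□` is invertible (the compression of the coercive `Q′G′_{T′}²Q′*` along an injection is coercive).
[cite: Balaban1984PropagatorsII, p.235 («Q′G′²Q′* is a positive operator»); Balaban1983RegularityDecay, (5.6) p.594] -/
theorem isUnit_AcompT (hc : ChartHyps P Mb m') (ha : 0 < a) (hm : 0 ≤ msq) (hK : 1 ≤ P.K) (k : CIdx P P.K Mb) :
    IsUnit (AcompT P Mb m' a msq k) := by
  classical
  have hco : Coercive (qggqK (smallVol P m') a msq) ((1 / Cq P.d a msq) ^ 2) :=
    coercive_qggqK_of_qgqK (smallVol P m') ha hm hK (one_div_pos.mpr (Cq_pos P.d ha hm)).le (coercive_qgq (smallVol P m') hK ha hm)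
  have hγ : 0 < (1 / Cq P.d a msq) ^ 2 := by have := Cq_pos P.d ha hm; positivity
  set c₀ : ℝ := ∑ p, ∑ q, |qggqK (smallVol P m') a msq p q| with hc₀
  have hA : Hyp56 (T1 (smallVol P m') (smallVol P m').K) (qggqK (smallVol P m') a msq) ((1 / Cq P.d a msq) ^ 2) c₀ 0 := by
    refine hyp56_qggqK (smallVol P m') ha hm hK hco fun p q => ?_
    rw [zero_mul, neg_zero, Real.exp_zero, mul_one, hc₀]
    exact (Finset.single_le_sum (f := fun q' => |qggqK (smallVol P m') a msq p q'|) (fun _ _ => abs_nonneg _)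
      (Finset.mem_univ q)).trans
      (Finset.single_le_sum (f := fun p' => ∑ q', |qggqK (smallVol P m') a msq p' q'|)
        (fun _ _ => Finset.sum_nonneg fun _ _ => abs_nonneg _) (Finset.mem_univ p))
  exact isUnit_of_hyp56 hγ (hyp56_submatrix hA (e := cubeEmb P Mb m' k) (cubeEmb_injective hc k))

/-- **(2.70) FOR THE MODIFIED PRESCRIPTION**: `Σ_{z∈□} X̃_k(y, z)·C_k(z, y″) = δ_{y,y″}` for `y, y″ ∈ □_k` — `C_□` IS the inverse of
`(Q′G′(□̃)²Q′*)↾□`. [cite: Balaban1984PropagatorsII, (2.70) p.235] -/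
theorem sum_cubeInd_Xloc_ClocT (hc : ChartHyps P Mb m') (ha : 0 < a) (hm : 0 ≤ msq) (hK : 1 ≤ P.K) (k : CIdx P P.K Mb)
    {y : Site P P.K} (hy : InCube P P.K Mb k y) (y'' : Site P P.K) :
    ∑ z, cubeInd P P.K Mb k z * (Xloc P Mb m' a msq k y z * ClocT P Mb m' a msq k z y'') =
      if InCube P P.K Mb k y'' then (if y = y'' then 1 else 0) else 0 := by
  classical
  by_cases hy'' : InCube P P.K Mb k y''
  · rw [if_pos hy'']
    have hmul : AcompT P Mb m' a msq k * (AcompT P Mb m' a msq k)⁻¹ = 1 :=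
      Matrix.mul_nonsing_inv _ ((Matrix.isUnit_iff_isUnit_det _).mp (isUnit_AcompT hc ha hm hK k))
    have hent := congrFun (congrFun hmul ⟨y, hy⟩) ⟨y'', hy''⟩
    rw [Matrix.mul_apply] at hent
    rw [sum_eq_sum_cube k _ (fun z hz => by rw [cubeInd_eq_zero hz, zero_mul])]
    have e : ∀ s : Cube P Mb k, cubeInd P P.K Mb k s.val * (Xloc P Mb m' a msq k y s.val * ClocT P Mb m' a msq k s.val y'') =
        AcompT P Mb m' a msq k ⟨y, hy⟩ s * (AcompT P Mb m' a msq k)⁻¹ s ⟨y'', hy''⟩ := by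
      intro s
      rw [cubeInd_eq_one s.property, one_mul, ClocT_eq_inv s.property hy'', Xloc_eq_of_inCube hy s.property]
      rfl
    rw [Finset.sum_congr rfl fun s _ => e s, hent, Matrix.one_apply]
    by_cases hyy : y = y''
    · subst hyy; simp
    · rw [if_neg hyy, if_neg (fun h => hyy (congrArg Subtype.val h))]
  · rw [if_neg hy'']
    exact Finset.sum_eq_zero fun z _ => by rw [ClocT_eq_zero_right z hy'', mul_zero, mul_zero]

/-- the localized operator `□X̃_k□` has entries `□(y)X̃_k(y,z)□(z)`. [folklore] -/
private theorem locOp_Pmat_apply (k : CIdx P P.K Mb) (y z : Site P P.K) :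
    locOp (Pmat P Mb) (XlocMat P Mb m' a msq) k y z = cubeInd P P.K Mb k y * Xloc P Mb m' a msq k y z * cubeInd P P.K Mb k z := by
  unfold locOp Pmat XlocMat
  rw [Matrix.mul_diagonal, Matrix.diagonal_mul, Matrix.of_apply]

/-- **(2.70) as the operator identity `(□X̃_□□)·C_□·h_□ = h_□`** for the modified prescription (the hypothesis `h270` of the cell's
(2.82)-algebra `B6Expansion282.expansion282`). [cite: Balaban1984PropagatorsII, (2.70) p.235] -/
theorem locOp_mul_ClocTMat_mul_Hmat (hc : ChartHyps P Mb m') (ha : 0 < a) (hm : 0 ≤ msq) (hK : 1 ≤ P.K) (k : CIdx P P.K Mb) :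
    locOp (Pmat P Mb) (XlocMat P Mb m' a msq) k * ClocTMat P Mb m' a msq k * Hmat P Mb k = Hmat P Mb k := by
  have hMb : 1 ≤ Mb := (sizes hc).1
  ext y y'
  unfold Hmat
  rw [Matrix.mul_diagonal, Matrix.mul_apply, Matrix.diagonal_apply]
  simp only [locOp_Pmat_apply, ClocTMat, Matrix.of_apply]
  have e : ∑ z, cubeInd P P.K Mb k y * Xloc P Mb m' a msq k y z * cubeInd P P.K Mb k z * ClocT P Mb m' a msq k z y' =
      cubeInd P P.K Mb k y * ∑ z, cubeInd P P.K Mb k z * (Xloc P Mb m' a msq k y z * ClocT P Mb m' a msq k z y') := by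
    rw [Finset.mul_sum]
    exact Finset.sum_congr rfl fun z _ => by ring
  rw [e]
  by_cases hy : InCube P P.K Mb k y
  · rw [sum_cubeInd_Xloc_ClocT hc ha hm hK k hy y', cubeInd_eq_one hy, one_mul]
    by_cases hy' : InCube P P.K Mb k y'
    · rw [if_pos hy']
      by_cases hyy : y = y'
      · subst hyy; simp
      · rw [if_neg hyy, if_neg hyy, zero_mul]
    · rw [if_neg hy', zero_mul]
      have hne : y ≠ y' := fun h => hy' (h ▸ hy)
      rw [if_neg hne]
  · rw [cubeInd_eq_zero hy, zero_mul, zero_mul]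
    by_cases hyy : y = y'
    · subst hyy
      have h0 : hcov P P.K Mb k y = 0 := by
        by_contra hne; exact hy (inCube_of_hcov_ne_zero hMb hne)
      rw [if_pos rfl, h0]
    · rw [if_neg hyy]

/-- **(2.82) FOR THE MODIFIED PRESCRIPTION**: `Q′G′²Q′*·C = I − R` on `T₁^{(K)}` with `C = Σ h_□C_□h_□`, `C_□ = ((Q′G′(□̃)²Q′*)↾□)⁻¹` —
the cell's verbatim algebra with its three hypotheses (□h_□ = h_□, (2.36), (2.70)) discharged on the genuine objects.
[cite: Balaban1984PropagatorsII, (2.82) p.237] -/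
theorem expansion282_modified (hc : ChartHyps P Mb m') (ha : 0 < a) (hm : 0 ≤ msq) (hK : 1 ≤ P.K) (hdiv : Mb ∣ P.sitesPerDir P.K)
    (h2 : 2 * Mb ≤ P.sitesPerDir P.K) : qggqK P a msq * CappT P Mb m' a msq = 1 - RrwT P Mb m' a msq :=
  expansion282 (qggqK P a msq) (Pmat_mul_Hmat (sizes hc).1) (partitionSq_Hmat (sizes hc).1 hdiv h2)
    (locOp_mul_ClocTMat_mul_Hmat hc ha hm hK)

/-- **(2.86), fixed-point form, MODIFIED PRESCRIPTION**: `(Q′G′²Q′*)⁻¹ = C + (Q′G′²Q′*)⁻¹R`. [cite: Balaban1984PropagatorsII, (2.86) p.238] -/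
theorem inv_eq_CappT_add (hc : ChartHyps P Mb m') (ha : 0 < a) (hm : 0 ≤ msq) (hK : 1 ≤ P.K) (hdiv : Mb ∣ P.sitesPerDir P.K)
    (h2 : 2 * Mb ≤ P.sitesPerDir P.K) :
    (qggqK P a msq)⁻¹ = CappT P Mb m' a msq + (qggqK P a msq)⁻¹ * RrwT P Mb m' a msq :=
  inverse_fixedPoint (B6QGGQInvTowerTorus.cinvK_mul P ha hm hK) (Pmat_mul_Hmat (sizes hc).1) (partitionSq_Hmat (sizes hc).1 hdiv h2)
    (locOp_mul_ClocTMat_mul_Hmat hc ha hm hK)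

/-- (2.86) truncated at any order, modified prescription: `(Q′G′²Q′*)⁻¹ = Σ_{n<N} CRⁿ + (Q′G′²Q′*)⁻¹R^N`. [cite: Balaban1984PropagatorsII, (2.86) p.238] -/
theorem inv_eq_sum_add_modified (hc : ChartHyps P Mb m') (ha : 0 < a) (hm : 0 ≤ msq) (hK : 1 ≤ P.K) (hdiv : Mb ∣ P.sitesPerDir P.K)
    (h2 : 2 * Mb ≤ P.sitesPerDir P.K) (N : ℕ) :
    (qggqK P a msq)⁻¹ = ∑ n ∈ Finset.range N, CappT P Mb m' a msq * RrwT P Mb m' a msq ^ n + (qggqK P a msq)⁻¹ * RrwT P Mb m' a msq ^ N :=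
  neumann_truncation (inv_eq_CappT_add hc ha hm hK hdiv h2) N

end Prescription

/-! ## §3  (2.81) for the modified `C_□` and (2.68) for `X̃_□`, uniformly on the family -/

section Decay

/-- the member `T′ = T_□̃` of the family: the volume `(d, L, m′, K)` with the big member's `Mb`, `R`. [cite: Balaban1984PropagatorsII, p.238; bookkeeping] -/
def smallIdx {d L : ℕ} (i : Index d L) (m' : ℕ) : Index d L := ⟨⟨smallVol i.P m', i.hPd, i.hPL, i.hK⟩, i.Mb, i.R⟩

/-- **(2.81) FOR THE MODIFIED `C_□ = ((Q′G′(□̃)²Q′*)↾□)⁻¹`, UNIFORMLY ON THE FAMILY**: there are `δ_C, B_C > 0` (functions of `d, L, a, m²`)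
with `|C_□(y, y′)| ≤ B_Ce^{−δ_C|y−y′|₁}` for every member, every admissible chart and every cube — [3] Sect. 5 (5.6) ⇒ (5.7) for the
compression of the coercive decaying `Q′G′_{T′}²Q′*` (member `T′` of the family: `coercive_qgq_family`, `ineq268_oneScaleTorus`) along the
injection `ι_K∘(□ ↪ 𝔅)`, and `|ι_Ky − ι_Ky′|′₁ ≥ |y − y′|₁` on the core; printed *"|C_□(y, y′)| ≤ O(1)(L^jη)^{−d−4}e^{−δ₁(L^jη)^{−1}|y−y′|}"*.
[cite: Balaban1984PropagatorsII, (2.81) p.237; Balaban1983RegularityDecay, (5.6)–(5.7) p.594] -/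
theorem ineq281_modified (d L : ℕ) (hd : 1 ≤ d) (hL : Odd L ∧ 1 < L) {a : ℝ} (ha : 0 < a) {msq : ℝ} (hmsq : 0 ≤ msq) :
    ∃ δC BC : ℝ, 0 < δC ∧ 0 < BC ∧ ∀ (i : Index d L) (Mb m' : ℕ), ChartHyps i.P Mb m' →
      ∀ (k : CIdx i.P i.P.K Mb) (y y' : Site i.P i.P.K),
        |ClocT i.P Mb m' a msq k y y'| ≤ BC * Real.exp (-(δC * T1 i.P i.P.K y y')) := by
  classical
  obtain ⟨δX, CX, hδX, hCX, h268⟩ := ineq268_oneScaleTorus d L hd hL ha hmsq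
  set γ₀ : ℝ := (1 / Cq d a msq) ^ 2 with hγ₀
  have hγ : 0 < γ₀ := by have := Cq_pos d ha hmsq; positivity
  have hK0 : ∀ t : ℝ, 0 < t → 0 ≤ (fun t => B6.c0 t 1 ^ d) t := fun t _ => pow_nonneg (B6RandomWalk.c0_nonneg t 1) d
  refine ⟨B4Sect5Torus.rate (fun t => B6.c0 t 1 ^ d) γ₀ CX δX, 2 / γ₀, B4Sect5Torus.rate_pos hK0 hγ hCX.le hδX, by positivity, ?_⟩
  intro i Mb m' hc k y y'
  by_cases hyy : InCube i.P i.P.K Mb k y ∧ InCube i.P i.P.K Mb k y'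
  · set i' := smallIdx i m' with hi'
    have hco : Coercive (qggqK (smallVol i.P m') a msq) γ₀ :=
      coercive_qggqK_of_qgqK (smallVol i.P m') ha hmsq i.hK (one_div_pos.mpr (Cq_pos d ha hmsq)).le (coercive_qgq_family d L ha hmsq i')
    have hA : Hyp56 (T1 (smallVol i.P m') (smallVol i.P m').K) (qggqK (smallVol i.P m') a msq) γ₀ CX δX :=
      hyp56_qggqK (smallVol i.P m') ha hmsq i.hK hco (h268 i')
    have hS : SumBound (T1 (smallVol i.P m') (smallVol i.P m').K) (fun t => B6.c0 t 1 ^ d) := by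
      have h := T1_sumBound (smallVol i.P m') (smallVol i.P m').K
      have e : (smallVol i.P m').d = d := i.hPd
      rwa [e] at h
    have h := inv_submatrix_decay hK0 hγ hCX.le hδX (T1_isPseudoDist (smallVol i.P m') (smallVol i.P m').K) hS hA
      (e := cubeEmb i.P Mb m' k) (cubeEmb_injective hc k) ⟨y, hyy.1⟩ ⟨y', hyy.2⟩
    rw [ClocT_eq_inv hyy.1 hyy.2]
    refine h.trans (mul_le_mul_of_nonneg_left (Real.exp_le_exp.mpr (neg_le_neg (mul_le_mul_of_nonneg_left ?_
      (B4Sect5Torus.rate_pos hK0 hγ hCX.le hδX).le))) (by positivity))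
    exact T1_le_T1_iotaK_of_mem_Vk hc (mem_Vk_of_inCube hc hyy.1) (mem_Vk_of_inCube hc hyy.2)
  · have h0 : ClocT i.P Mb m' a msq k y y' = 0 := by unfold ClocT; rw [dif_neg hyy]
    rw [h0, abs_zero]
    positivity

/-- **(2.68) FOR `X̃_□`**, uniformly on the family: `|X̃_k(y, y″)| ≤ C_Xe^{−δ_X|y−y″|₁}` with the constants of `ineq268_oneScaleTorus`
((2.68) for the member `T′`, then `|ι_Ky − ι_Ky″|′₁ ≥ |y − y″|₁` on `□ ⊂ V`; zero off `□ × □`). [cite: Balaban1984PropagatorsII, (2.68) p.235] -/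
theorem abs_Xloc_le {d L : ℕ} {a msq δX CX : ℝ} (hCX : 0 ≤ CX) (hδX : 0 ≤ δX)
    (h268 : ∀ i : Index d L, ∀ y y', |qggqK i.P a msq y y'| ≤ CX * Real.exp (-(δX * T1 i.P i.P.K y y')))
    (i : Index d L) {Mb m' : ℕ} (hc : ChartHyps i.P Mb m') (k : CIdx i.P i.P.K Mb) (y y'' : Site i.P i.P.K) :
    |Xloc i.P Mb m' a msq k y y''| ≤ CX * Real.exp (-(δX * T1 i.P i.P.K y y'')) := by
  by_cases hy : InCube i.P i.P.K Mb k y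
  · by_cases hy'' : InCube i.P i.P.K Mb k y''
    · rw [Xloc_eq_of_inCube hy hy'']
      refine (h268 (smallIdx i m') _ _).trans (mul_le_mul_of_nonneg_left (Real.exp_le_exp.mpr (neg_le_neg
        (mul_le_mul_of_nonneg_left ?_ hδX))) hCX)
      exact T1_le_T1_iotaK_of_mem_Vk hc (mem_Vk_of_inCube hc hy) (mem_Vk_of_inCube hc hy'')
    · rw [(Xloc_eq_zero_of_not_inCube hy'' y).2, abs_zero]; positivity
  · rw [(Xloc_eq_zero_of_not_inCube hy y'').1, abs_zero]; positivity

end Decay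

end

end Literature.MathematicalPhysics.QuantumFieldTheory.Balaban1983to89.B6ModifiedPrescription270Torus
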